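import Literature.Topology.PlaneTopology.ArgumentIncrement
import Literature.Topology.PlaneTopology.HalfPlaneEnclosure
import HarnessLib

/-!
# Three disjoint arcs across an annulus: no complementary region touches all three

Topic: Topology / PlaneTopology (companion to `ArgumentIncrement.lean`). The planar input of
the "sector" argument of M. Aizenman, A. Burchard, *Hölder regularity and dimension bounds for
random curves*, Duke Math. J. 99 (1999), Appendix A ("the `k` crossing segments cut the annulus
into sectors, each containing an open or a dual-open crossing"), in the minimal form consumed by
the multiple-traversal estimate for the loop ensemble of critical site percolation
(`Literature.Probability.Percolation.isTightLaws_map_triLoopCollection`): if three pairwise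
disjoint paths `T₀, T₁, T₂` run inside the closed annulus `q₁ ≤ |z - x| ≤ q₂`, each meeting the
outer circle in exactly one point (its endpoint `fᵢ`) and the inner circle in exactly one point
(its starting point `eᵢ`), then **no connected subset `S` of the open annulus missing the three
paths has all three of them in its closure** (`not_three_arcs_touch`). Consequently a map
assigning to each of `k` such arcs a complementary region adjacent to it takes each value at
most twice — the count of sectors used downstream.

The proof uses winding numbers only (no Jordan curve theorem). For the cyclic order
`θ₀ < θ₁ < θ₂ < θ₀ + 2π` of the outer endpoints `fᵢ = x + q₂ e^{iθᵢ}`, close `Tᵢ` and `Tⱼ`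
(`(i, j) = (0, 1), (1, 2), (2, 0)`) into a loop `Jᵢⱼ = Tᵢ · βᵢⱼ · Tⱼ⁻¹ · αⱼᵢ` with the
counter-clockwise outer arc `βᵢⱼ` from `fᵢ` to `fⱼ`, which avoids the third endpoint `f_k`, and
the broken line `αⱼᵢ = [eⱼ, x] ∪ [x, eᵢ]` through the centre. The third path `T_k`, the ray from
`f_k` outwards and a small disc about a point of `T_k` in the closure of `S` form, with `S`, a
connected set missing `Jᵢⱼ` and reaching infinity, so `Jᵢⱼ` does not wind about the points of
`S` (`wind_sub_eq_of_mem_connectedComponentIn`). But the sum of the three argument increments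
at a point `p` of the open annulus is that of the full outer circle (the `T`'s and the radii
cancel), `2πi ≠ 0` — contradiction.

Contents: circular arcs as paths (`circleArc`) and their argument increments through a global
logarithm of `θ ↦ x + r e^{iθ} - p` (`exists_log_circleMap_sub`, `Path.argInc_circleArc`,
`argInc_three_circleArcs`); loops in a disc do not wind about exterior points
(`wind_sub_eq_zero_of_dist_le`); the theorem, first for ordered outer angles
(`not_three_arcs_touch_of_lt`), then in general (`not_three_arcs_touch`).

## References

* M. Aizenman, A. Burchard, Duke Math. J. 99 (1999), Appendix A [AizenmanBurchardDuke1999].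
* L. V. Ahlfors, *Complex Analysis*, 3rd ed., §4.2.1 (winding numbers; constancy on
  complementary components).
-/

noncomputable section

open Complex Set Metric Topology Filter
open scoped Real

namespace Literature.Topology.PlaneTopology

/-! ### Circular arcs as paths -/

/-- The **circular arc** `θ ↦ x + r e^{iθ}`, `θ` running affinely from `θ₁` to `θ₂` (in either
direction), as a path from `circleMap x r θ₁` to `circleMap x r θ₂`. [folklore] -/
def circleArc (x : ℂ) (r θ₁ θ₂ : ℝ) : Path (circleMap x r θ₁) (circleMap x r θ₂) :=
  (Path.segment θ₁ θ₂).map (continuous_circleMap' x r)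

/-- Pointwise formula for the circular arc. [folklore] -/
theorem circleArc_apply (x : ℂ) (r θ₁ θ₂ : ℝ) (t : unitInterval) :
    circleArc x r θ₁ θ₂ t = circleMap x r (AffineMap.lineMap θ₁ θ₂ (t : ℝ)) := rfl

/-- The extension to `ℝ` of the circular arc on `[0, 1]`. [folklore] -/
theorem circleArc_extend (x : ℂ) (r θ₁ θ₂ : ℝ) {t : ℝ} (ht : t ∈ Icc (0 : ℝ) 1) :
    (circleArc x r θ₁ θ₂).extend t = circleMap x r (AffineMap.lineMap θ₁ θ₂ t) := by
  rw [Path.extend_apply _ ht]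
  rfl

/-- The range of the circular arc is the image of the angle interval. [folklore] -/
theorem range_circleArc (x : ℂ) (r θ₁ θ₂ : ℝ) :
    range (circleArc x r θ₁ θ₂) = circleMap x r '' uIcc θ₁ θ₂ := by
  change range (circleMap x r ∘ Path.segment θ₁ θ₂) = _
  rw [range_comp, Path.range_segment, segment_eq_uIcc]

/-- Points of the circular arc lie on the circle. [folklore] -/
theorem dist_circleArc (x : ℂ) {r : ℝ} (hr : 0 ≤ r) (θ₁ θ₂ : ℝ) (t : unitInterval) :
    dist (circleArc x r θ₁ θ₂ t) x = r := by
  rw [circleArc_apply]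
  exact circleMap_mem_sphere x hr _

/-- Two angles with the same point on a circle of nonzero radius differ by a multiple of `2π`.
[folklore] -/
theorem exists_int_of_circleMap_eq {x : ℂ} {r : ℝ} (hr : r ≠ 0) {a b : ℝ}
    (h : circleMap x r a = circleMap x r b) : ∃ n : ℤ, a = b + n * (2 * π) := by
  obtain ⟨n, hn⟩ := (circleMap_eq_circleMap_iff x hr).1 h
  refine ⟨n, ?_⟩
  have h1 : (a : ℂ) * I = ((b : ℂ) + (n : ℂ) * (2 * (π : ℂ))) * I := by rw [hn]; ring
  have h2 := mul_right_cancel₀ I_ne_zero h1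
  exact_mod_cast h2

/-- **Avoidance.** If no representative `φ + 2πn` of the angle `φ` lies in the angle interval
of the arc, the point `circleMap x r φ` is not on the arc. [folklore] -/
theorem circleMap_not_mem_range_circleArc {x : ℂ} {r : ℝ} (hr : r ≠ 0) {θ₁ θ₂ φ : ℝ}
    (h : ∀ n : ℤ, φ + n * (2 * π) ∉ uIcc θ₁ θ₂) :
    circleMap x r φ ∉ range (circleArc x r θ₁ θ₂) := by
  rw [range_circleArc]
  rintro ⟨θ, hθ, hθφ⟩
  obtain ⟨n, hn⟩ := exists_int_of_circleMap_eq hr hθφ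
  exact h n (hn ▸ hθ)

/-- Angle bookkeeping for the avoidance: if `b < φ < a + 2π` then no `φ + 2πn` lies in `[a, b]`.
[folklore] -/
theorem forall_add_int_mul_not_mem_Icc {a b φ : ℝ} (h1 : b < φ) (h2 : φ < a + 2 * π) :
    ∀ n : ℤ, φ + n * (2 * π) ∉ Icc a b := by
  intro n hn
  obtain ⟨ha, hb⟩ := hn
  rcases lt_trichotomy n 0 with hneg | rfl | hpos
  · have : (n : ℝ) ≤ -1 := by exact_mod_cast Int.le_sub_one_of_lt hneg
    nlinarith [Real.pi_pos]
  · simp at hb; linarith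
  · have : (1 : ℝ) ≤ n := by exact_mod_cast hpos
    nlinarith [Real.pi_pos]

/-! ### A global logarithm of `θ ↦ x + r e^{iθ} - p` for `p` inside the circle -/

/-- Points of the circle of radius `r` about `x` are at distance `≥ r - dist p x` from `p`; in
particular `circleMap x r θ ≠ p` when `dist p x < r`. [folklore] -/
theorem circleMap_sub_ne_zero {x p : ℂ} {r : ℝ} (hp : dist p x < r) (θ : ℝ) :
    circleMap x r θ - p ≠ 0 := by
  intro h
  rw [sub_eq_zero] at h
  have : dist p x = r := by
    rw [← h]
    exact circleMap_mem_sphere x (dist_nonneg.trans hp.le) θ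
  linarith

/-- The rotated circle loop `t ↦ x + r e^{i(θ + 2πt)} - p` winds once about `0` when
`dist p x < r`. [folklore] -/
theorem wind_circleMap_add_sub {x p : ℂ} {r : ℝ} (hp : dist p x < r) (θ : ℝ) :
    wind (fun t => circleMap x r (θ + 2 * π * t) - p) = 1 := by
  have hr : 0 < r := dist_nonneg.trans_lt hp
  set u : ℂ := exp (θ * I) with hu
  have hu0 : u ≠ 0 := exp_ne_zero _
  set c : ℂ := u⁻¹ * (x - p) with hc
  -- factorisation `circleMap x r (θ + 2πt) - p = u * circleLoop c r t`
  have hfac : ∀ t : ℝ, circleMap x r (θ + 2 * π * t) - p = u * circleLoop c r t := by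
    intro t
    rw [circleLoop, circleMap, circleMap, hc, mul_add, ← mul_assoc, mul_inv_cancel₀ hu0, one_mul,
      hu]
    push_cast
    simp only [add_mul, Complex.exp_add]
    ring
  have hcn : ‖c‖ < r := by
    rw [hc, norm_mul, norm_inv, hu, norm_exp_ofReal_mul_I, inv_one, one_mul, ← dist_eq_norm,
      dist_comm]
    exact hp
  have h1 : wind (fun t => u * circleLoop c r t) = wind (fun _ : ℝ => u) + wind (circleLoop c r) :=
    wind_mul (IsNonvanishingLoop.const hu0)
      (isNonvanishingLoop_circleLoop (by rw [abs_of_pos hr]; exact hcn.ne))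
  have h2 : wind (circleLoop c r) = 1 := by
    have := wind_circleLoop_sub_of_norm_lt (c := c) (a := 0) (R := r) (by simpa using hcn)
    simpa using this
  rw [show (fun t => circleMap x r (θ + 2 * π * t) - p) = fun t => u * circleLoop c r t from
    funext hfac, h1, wind_const, h2, zero_add]

/-- **A global logarithm along the circle.** For `dist p x < r` there is a continuous
`Λ : ℝ → ℂ` with `exp (Λ θ) = x + r e^{iθ} - p` and `Λ (θ + 2π) = Λ θ + 2πi` (the lift gains
one turn per revolution, `wind_circleMap_add_sub`). [folklore] -/
theorem exists_log_circleMap_sub {x p : ℂ} {r : ℝ} (hp : dist p x < r) :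
    ∃ Λ : ℝ → ℂ, Continuous Λ ∧ (∀ θ, exp (Λ θ) = circleMap x r θ - p) ∧
      ∀ θ, Λ (θ + 2 * π) = Λ θ + 2 * π * I := by
  have hF : Continuous fun θ => circleMap x r θ - p := (continuous_circleMap' x r).sub continuous_const
  obtain ⟨Λ, hΛc, hΛe⟩ := hasLogOn_univ isSimplyConnected_univ_real hF (circleMap_sub_ne_zero hp)
  have hΛc' : Continuous Λ := continuousOn_univ.1 hΛc
  refine ⟨Λ, hΛc', fun θ => hΛe θ (mem_univ _), fun θ => ?_⟩
  -- the loop `t ↦ F (θ + 2πt)` has the logarithm `t ↦ Λ (θ + 2πt)` and winds once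
  have hl : ContinuousOn (fun t : ℝ => Λ (θ + 2 * π * t)) (Icc 0 1) := by fun_prop
  have hle : ∀ t ∈ Icc (0 : ℝ) 1, exp (Λ (θ + 2 * π * t)) = circleMap x r (θ + 2 * π * t) - p :=
    fun t _ => hΛe _ (mem_univ _)
  have h01 : circleMap x r (θ + 2 * π * 0) - p = circleMap x r (θ + 2 * π * 1) - p := by
    rw [mul_zero, add_zero, mul_one, periodic_circleMap]
  have := wind_spec hl hle h01
  rw [wind_circleMap_add_sub hp θ, Int.cast_one, one_mul, mul_one, mul_zero, add_zero] at this
  rw [← this]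
  ring

/-- **Argument increment of a circular arc through the global logarithm**: with `Λ` as in
`exists_log_circleMap_sub`, `argInc (circleArc x r θ₁ θ₂) p = Λ θ₂ - Λ θ₁`. [folklore] -/
theorem _root_.Path.argInc_circleArc {x p : ℂ} {r : ℝ} {Λ : ℝ → ℂ} (hΛc : Continuous Λ)
    (hΛe : ∀ θ, exp (Λ θ) = circleMap x r θ - p) (θ₁ θ₂ : ℝ) :
    (circleArc x r θ₁ θ₂).argInc p = Λ θ₂ - Λ θ₁ := by
  unfold Path.argInc
  have hl : ContinuousOn (fun t : ℝ => Λ (AffineMap.lineMap θ₁ θ₂ t)) (Icc 0 1) :=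
    (hΛc.comp AffineMap.lineMap_continuous).continuousOn
  rw [logInc_eq hl fun t ht => by rw [hΛe, circleArc_extend _ _ _ _ ht]]
  simp

/-- **Three consecutive arcs make one turn**: for any angles `θ₀, θ₁, θ₂` and `dist p x < r`,
`argInc (arc θ₀ θ₁) + argInc (arc θ₁ θ₂) + argInc (arc θ₂ (θ₀ + 2π)) = 2πi` at `p`.
[folklore] -/
theorem argInc_three_circleArcs {x p : ℂ} {r : ℝ} (hp : dist p x < r) (θ₀ θ₁ θ₂ : ℝ) :
    (circleArc x r θ₀ θ₁).argInc p + (circleArc x r θ₁ θ₂).argInc p +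
      (circleArc x r θ₂ (θ₀ + 2 * π)).argInc p = 2 * π * I := by
  obtain ⟨Λ, hΛc, hΛe, hΛs⟩ := exists_log_circleMap_sub hp
  rw [Path.argInc_circleArc hΛc hΛe, Path.argInc_circleArc hΛc hΛe, Path.argInc_circleArc hΛc hΛe,
    hΛs]
  ring

/-! ### Loops in a disc do not wind about exterior points -/

/-- A loop in the closed disc `B̄(x, r)` has winding number `0` about every point at distance
`> r` from `x` (Rouché against the constant loop `x - z`). [folklore] -/
theorem wind_sub_eq_zero_of_dist_le {Γ : ℝ → ℂ} (hΓ : ContinuousOn Γ (Icc 0 1)) (h01 : Γ 0 = Γ 1)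
    {x z : ℂ} {r : ℝ} (hr : ∀ t ∈ Icc (0 : ℝ) 1, dist (Γ t) x ≤ r) (hz : r < dist z x) :
    wind (fun t => Γ t - z) = 0 := by
  have hxz : x - z ≠ 0 := by
    rw [sub_ne_zero]
    rintro rfl
    have := hr 0 ⟨le_rfl, zero_le_one⟩
    rw [dist_self] at hz
    linarith [dist_nonneg (x := Γ 0) (y := x)]
  rw [← wind_const (x - z)]
  refine wind_eq_of_norm_sub_lt (hΓ.sub continuousOn_const) (by rw [h01])
    (IsNonvanishingLoop.const hxz) fun t ht => ?_
  have e : Γ t - z - (x - z) = Γ t - x := by ring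
  rw [e, ← dist_eq_norm, ← dist_eq_norm, dist_comm x z]
  exact (hr t ht).trans_lt hz

/-- A loop (as a `Path`) in the closed disc `B̄(x, r)` has zero argument increment about every
point at distance `> r` from `x`. [folklore] -/
theorem _root_.Path.argInc_eq_zero_of_dist_le {a : ℂ} (γ : Path a a) {x z : ℂ} {r : ℝ}
    (hr : ∀ t, dist (γ t) x ≤ r) (hz : r < dist z x) : γ.argInc z = 0 := by
  have hzr : z ∉ range γ := by
    rintro ⟨t, rfl⟩
    exact (lt_irrefl _) ((hr t).trans_lt hz)
  rw [Path.argInc_eq_wind_mul _ hzr, wind_sub_eq_zero_of_dist_le γ.continuous_extend.continuousOn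
    (by simp) (fun t ht => by rw [Path.extend_apply _ ht]; exact hr _) hz]
  simp

/-! ### Segments towards the centre -/

/-- Points of the segment `[e, x]` are no farther from `x` than `e`. [folklore] -/
theorem dist_le_of_mem_segment_center {e x z : ℂ} (hz : z ∈ segment ℝ e x) :
    dist z x ≤ dist e x :=
  (convex_closedBall x (dist e x)).segment_subset (mem_closedBall.2 le_rfl)
    (mem_closedBall.2 (by rw [dist_self]; exact dist_nonneg)) hz

/-- The only point of the segment `[e, x]` as far from `x` as `e` is `e` itself. [folklore] -/
theorem eq_of_mem_segment_center_of_dist_eq {e x z : ℂ} (hz : z ∈ segment ℝ e x)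
    (h : dist z x = dist e x) (hex : e ≠ x) : z = e := by
  rw [segment_eq_image_lineMap] at hz
  obtain ⟨t, ⟨ht0, ht1⟩, rfl⟩ := hz
  have e1 : AffineMap.lineMap e x t - x = (1 - t : ℝ) • (e - x) := by
    rw [AffineMap.lineMap_apply_module]
    simp only [sub_smul, one_smul, smul_sub]
    abel
  rw [dist_eq_norm, e1, norm_smul, Real.norm_eq_abs, abs_of_nonneg (by linarith), dist_eq_norm] at h
  have hne : ‖e - x‖ ≠ 0 := by rwa [norm_ne_zero_iff, sub_ne_zero]
  have ht : t = 0 := by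
    have : (1 - t) * ‖e - x‖ = 1 * ‖e - x‖ := by rw [one_mul]; exact h
    have := mul_right_cancel₀ hne this
    linarith
  subst ht
  simp

/-- The argument increment is unchanged by `Path.cast`. [folklore] -/
theorem _root_.Path.argInc_cast {a b a' b' : ℂ} (γ : Path a b) (ha : a' = a) (hb : b' = b) (p : ℂ) :
    (γ.cast ha hb).argInc p = γ.argInc p := rfl

/-! ### Closing two arcs into a loop -/

/-- The **close-up loop** of two paths `Tᵢ : eᵢ ⟶ fᵢ`, `Tⱼ : eⱼ ⟶ fⱼ` across the annulus
`q₁ ≤ |z - x| ≤ q₂`: `Tᵢ`, the outer circular arc from `fᵢ = x + q₂e^{iφ₁}` to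
`fⱼ = x + q₂ e^{iφ₂}`, `Tⱼ` backwards, and the broken line `[eⱼ, x] ∪ [x, eᵢ]` through the
centre (Aizenman–Burchard 1999, App. A: the loop bounding a "sector"). [folklore] -/
def closeUp {ei fi ej fj : ℂ} (Ti : Path ei fi) (Tj : Path ej fj) (x : ℂ) (q₂ φ₁ φ₂ : ℝ)
    (hi : fi = circleMap x q₂ φ₁) (hj : fj = circleMap x q₂ φ₂) : Path ei ei :=
  Ti.trans (((circleArc x q₂ φ₁ φ₂).cast hi hj).trans
    (Tj.symm.trans ((Path.segment ej x).trans (Path.segment x ei))))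

section CloseUp

variable {ei fi ej fj : ℂ} (Ti : Path ei fi) (Tj : Path ej fj) (x : ℂ) (q₂ φ₁ φ₂ : ℝ)
  (hi : fi = circleMap x q₂ φ₁) (hj : fj = circleMap x q₂ φ₂)

/-- A point off the five pieces is off the close-up loop. [folklore] -/
theorem not_mem_range_closeUp {z : ℂ} (h₁ : z ∉ range Ti) (h₂ : z ∉ range (circleArc x q₂ φ₁ φ₂))
    (h₃ : z ∉ range Tj) (h₄ : z ∉ segment ℝ ej x) (h₅ : z ∉ segment ℝ x ei) :
    z ∉ range (closeUp Ti Tj x q₂ φ₁ φ₂ hi hj) := by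
  rw [closeUp, Path.trans_range, Path.trans_range, Path.trans_range, Path.trans_range,
    Path.symm_range, Path.range_segment, Path.range_segment]
  rintro (h | h | h | h | h)
  · exact h₁ h
  · exact h₂ (by rwa [Path.cast_coe] at h)
  · exact h₃ h
  · exact h₄ h
  · exact h₅ h

/-- Every point of the close-up loop is on one of the five pieces. [folklore] -/
theorem mem_range_closeUp_cases {z : ℂ} (hz : z ∈ range (closeUp Ti Tj x q₂ φ₁ φ₂ hi hj)) :
    z ∈ range Ti ∨ z ∈ range (circleArc x q₂ φ₁ φ₂) ∨ z ∈ range Tj ∨ z ∈ segment ℝ ej x ∨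
      z ∈ segment ℝ x ei := by
  by_contra hcon
  simp only [not_or] at hcon
  exact not_mem_range_closeUp Ti Tj x q₂ φ₁ φ₂ hi hj hcon.1 hcon.2.1 hcon.2.2.1 hcon.2.2.2.1
    hcon.2.2.2.2 hz

/-- **Expansion of the argument increment of the close-up loop** at a point off its pieces:
`argInc Tᵢ + argInc (arc) - argInc Tⱼ + argInc [eⱼ, x] + argInc [x, eᵢ]`. [folklore] -/
theorem argInc_closeUp {p : ℂ} (h₁ : p ∉ range Ti) (h₂ : p ∉ range (circleArc x q₂ φ₁ φ₂))
    (h₃ : p ∉ range Tj) (h₄ : p ∉ segment ℝ ej x) (h₅ : p ∉ segment ℝ x ei) :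
    (closeUp Ti Tj x q₂ φ₁ φ₂ hi hj).argInc p =
      Ti.argInc p + (circleArc x q₂ φ₁ φ₂).argInc p - Tj.argInc p +
        (Path.segment ej x).argInc p + (Path.segment x ei).argInc p := by
  have h₂' : p ∉ range ((circleArc x q₂ φ₁ φ₂).cast hi hj) := by rwa [Path.cast_coe]
  have h₃' : p ∉ range Tj.symm := by rwa [Path.symm_range]
  have h₄' : p ∉ range (Path.segment ej x) := by rwa [Path.range_segment]
  have h₅' : p ∉ range (Path.segment x ei) := by rwa [Path.range_segment]
  have h45 : p ∉ range ((Path.segment ej x).trans (Path.segment x ei)) := by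
    rw [Path.trans_range]; rintro (h | h); exacts [h₄' h, h₅' h]
  have h345 : p ∉ range (Tj.symm.trans ((Path.segment ej x).trans (Path.segment x ei))) := by
    rw [Path.trans_range]; rintro (h | h); exacts [h₃' h, h45 h]
  have h2345 : p ∉ range (((circleArc x q₂ φ₁ φ₂).cast hi hj).trans
      (Tj.symm.trans ((Path.segment ej x).trans (Path.segment x ei)))) := by
    rw [Path.trans_range]; rintro (h | h); exacts [h₂' h, h345 h]
  rw [closeUp, Path.argInc_trans _ _ h₁ h2345, Path.argInc_trans _ _ h₂' h345,
    Path.argInc_trans _ _ h₃' h45, Path.argInc_trans _ _ h₄' h₅', Path.argInc_symm _ h₃,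
    Path.argInc_cast]
  ring

end CloseUp

/-! ### The heart: the close-up loop does not wind about the touching region -/

section Heart

variable {ι : Type*} {x : ℂ} {q₁ q₂ : ℝ} {e f : ι → ℂ}

/-- Distance from the centre of the points `x + s (f - x)` of the ray through `f`. [folklore] -/
theorem dist_ray_point (x f : ℂ) {s : ℝ} (hs : 0 ≤ s) :
    dist (x + (s : ℂ) * (f - x)) x = s * dist f x := by
  rw [dist_eq_norm, add_sub_cancel_left, norm_mul, Complex.norm_real, Real.norm_eq_abs,
    abs_of_nonneg hs, dist_eq_norm]

/-- **The close-up loop `Jᵢⱼ` does not wind about the points of `S`.** Setting: paths `T_l`,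
`l : ι`, in the closed annulus `q₁ ≤ |z - x| ≤ q₂` from `e_l` (on the inner circle, the only
point of `T_l` there) to `f_l` (on the outer circle, the only point of `T_l` there), pairwise
disjoint; `S` a preconnected subset of the open annulus missing all of them; three distinct
indices `i, j, k` such that the outer arc from `fᵢ` to `fⱼ` misses `f_k` and the closure of `S`
meets `T_k` inside the open annulus. Then `argInc Jᵢⱼ p = 0` for `p ∈ S`: the set
`S ∪ B(m, ε) ∪ T_k ∪ {x + s(f_k - x) : s ≥ 1}` (`m` a point of `T_k` in the closure of `S`) is
connected, misses `Jᵢⱼ` and contains points far away, about which a loop in `B̄(x, q₂)` does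
not wind, and winding numbers are constant on complementary components
(`wind_sub_eq_of_mem_connectedComponentIn`). [cite: AizenmanBurchardDuke1999, Appendix A] -/
theorem argInc_closeUp_eq_zero (hq₁ : 0 < q₁) (hq₁₂ : q₁ < q₂) (T : ∀ l, Path (e l) (f l))
    (he : ∀ l, dist (e l) x = q₁) (hf : ∀ l, dist (f l) x = q₂)
    (hann : ∀ l t, q₁ ≤ dist (T l t) x ∧ dist (T l t) x ≤ q₂)
    (hin : ∀ l t, dist (T l t) x = q₁ → T l t = e l)
    (hout : ∀ l t, dist (T l t) x = q₂ → T l t = f l)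
    (hdisj : ∀ l l', l ≠ l' → Disjoint (range (T l)) (range (T l')))
    {S : Set ℂ} (hS : IsPreconnected S) (hSann : ∀ z ∈ S, q₁ < dist z x ∧ dist z x < q₂)
    (hST : ∀ l, Disjoint S (range (T l)))
    {i j k : ι} (hik : i ≠ k) (hjk : j ≠ k) {φ₁ φ₂ : ℝ}
    (hφ₁ : f i = circleMap x q₂ φ₁) (hφ₂ : f j = circleMap x q₂ φ₂)
    (havoid : f k ∉ range (circleArc x q₂ φ₁ φ₂))
    (htouch : (closure S ∩ range (T k) ∩ {z | q₁ < dist z x ∧ dist z x < q₂}).Nonempty)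
    {p : ℂ} (hp : p ∈ S) :
    (closeUp (T i) (T j) x q₂ φ₁ φ₂ hφ₁ hφ₂).argInc p = 0 := by
  set J := closeUp (T i) (T j) x q₂ φ₁ φ₂ hφ₁ hφ₂ with hJ
  have hq₂ : 0 < q₂ := hq₁.trans hq₁₂
  have heT : ∀ l, e l ∈ range (T l) := fun l => ⟨0, (T l).source⟩
  have hfT : ∀ l, f l ∈ range (T l) := fun l => ⟨1, (T l).target⟩
  have hdisj' : ∀ {l l'}, l ≠ l' → ∀ {z}, z ∈ range (T l) → z ∉ range (T l') :=
    fun h _ hz hz' => Set.disjoint_left.1 (hdisj _ _ h) hz hz'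
  have hex : ∀ l, e l ≠ x := fun l h => by
    have := he l; rw [h, dist_self] at this; linarith
  /- points off the pieces -/
  have hseg : ∀ z, q₁ < dist z x → z ∉ segment ℝ (e j) x ∧ z ∉ segment ℝ x (e i) := by
    intro z hz
    constructor
    · intro h; have := dist_le_of_mem_segment_center h; rw [he j] at this; linarith
    · intro h
      rw [segment_symm] at h
      have := dist_le_of_mem_segment_center h; rw [he i] at this; linarith
  have harc : ∀ z, dist z x ≠ q₂ → z ∉ range (circleArc x q₂ φ₁ φ₂) := by
    rintro z hz ⟨t, rfl⟩
    exact hz (dist_circleArc x hq₂.le φ₁ φ₂ t)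
  -- the endpoints `e k` are off the two radii
  have hek : e k ∉ segment ℝ (e j) x ∧ e k ∉ segment ℝ x (e i) := by
    constructor
    · intro h
      have h1 := eq_of_mem_segment_center_of_dist_eq h (by rw [he k, he j]) (hex j)
      exact hdisj' hjk.symm (heT k) (by rw [h1]; exact heT j)
    · intro h
      rw [segment_symm] at h
      have h1 := eq_of_mem_segment_center_of_dist_eq h (by rw [he k, he i]) (hex i)
      exact hdisj' hik.symm (heT k) (by rw [h1]; exact heT i)
  -- points of `T k` are off the loop
  have hTk : ∀ z ∈ range (T k), z ∉ range J := by
    intro z hz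
    obtain ⟨t, rfl⟩ := hz
    refine not_mem_range_closeUp _ _ _ _ _ _ _ _ (hdisj' hik.symm ⟨t, rfl⟩) ?_
      (hdisj' hjk.symm ⟨t, rfl⟩) ?_ ?_
    · by_cases hd : dist (T k t) x = q₂
      · rw [hout k t hd]; exact havoid
      · exact harc _ hd
    · by_cases hd : dist (T k t) x = q₁
      · rw [hin k t hd]; exact hek.1
      · exact (hseg _ (lt_of_le_of_ne (hann k t).1 (Ne.symm hd))).1
    · by_cases hd : dist (T k t) x = q₁
      · rw [hin k t hd]; exact hek.2
      · exact (hseg _ (lt_of_le_of_ne (hann k t).1 (Ne.symm hd))).2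
  -- points of `S` are off the loop
  have hSJ : ∀ z ∈ S, z ∉ range J := fun z hz =>
    not_mem_range_closeUp _ _ _ _ _ _ _ _ (Set.disjoint_left.1 (hST i) hz)
      (harc z (hSann z hz).2.ne) (Set.disjoint_left.1 (hST j) hz) (hseg z (hSann z hz).1).1
      (hseg z (hSann z hz).1).2
  -- the ray from `f k`
  set ray : Set ℂ := (fun s : ℝ => x + (s : ℂ) * (f k - x)) '' Ici 1 with hray
  have hray_conn : IsPreconnected ray :=
    isPreconnected_Ici.image _ (by fun_prop : Continuous fun s : ℝ => x + (s : ℂ) * (f k - x)).continuousOn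
  have hfk_ray : f k ∈ ray := ⟨1, mem_Ici.2 le_rfl, by push_cast; ring⟩
  have hrayJ : ∀ z ∈ ray, z ∉ range J := by
    rintro z ⟨s, hs, rfl⟩
    have hs1 : (1 : ℝ) ≤ s := hs
    have hd : dist (x + (s : ℂ) * (f k - x)) x = s * q₂ := by
      rw [dist_ray_point x (f k) (by linarith), hf k]
    have hq : q₂ ≤ s * q₂ := by nlinarith
    rcases hs1.eq_or_lt with h1 | h1
    · -- `s = 1`: the point is `f k`
      subst h1
      have e1 : x + ((1 : ℝ) : ℂ) * (f k - x) = f k := by push_cast; ring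
      change x + ((1 : ℝ) : ℂ) * (f k - x) ∉ range J
      rw [e1]
      exact not_mem_range_closeUp _ _ _ _ _ _ _ _ (hdisj' hik.symm (hfT k)) havoid
        (hdisj' hjk.symm (hfT k)) (hseg _ (by rw [hf k]; exact hq₁₂)).1
        (hseg _ (by rw [hf k]; exact hq₁₂)).2
    · have hgt : q₂ < dist (x + (s : ℂ) * (f k - x)) x := by rw [hd]; nlinarith
      refine not_mem_range_closeUp _ _ _ _ _ _ _ _ ?_ (harc _ hgt.ne') ?_
        (hseg _ (hq₁₂.trans hgt)).1 (hseg _ (hq₁₂.trans hgt)).2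
      · rintro ⟨t, ht⟩; have := (hann i t).2; rw [ht] at this; linarith
      · rintro ⟨t, ht⟩; have := (hann j t).2; rw [ht] at this; linarith
  /- the touching point and a small disc about it -/
  obtain ⟨m, ⟨hmS, hmT⟩, hm1, hm2⟩ := htouch
  have hmJ : m ∉ range J := hTk m hmT
  have hJc : IsClosed (range J) := (isCompact_range J.continuous).isClosed
  obtain ⟨ε, hε, hball⟩ := Metric.mem_nhds_iff.1 (hJc.isOpen_compl.mem_nhds hmJ)
  obtain ⟨y, hyS, hy⟩ := Metric.mem_closure_iff.1 hmS ε hε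
  have hyB : y ∈ ball m ε := by rw [mem_ball, dist_comm]; exact hy
  /- the connected set reaching infinity -/
  set W : Set ℂ := S ∪ ball m ε ∪ range (T k) ∪ ray with hW
  have hWc : IsPreconnected W := by
    have h1 : IsPreconnected (S ∪ ball m ε) :=
      IsPreconnected.union y hyS hyB hS (convex_ball m ε).isPreconnected
    have h2 : IsPreconnected (S ∪ ball m ε ∪ range (T k)) :=
      IsPreconnected.union m (Or.inr (mem_ball_self hε)) hmT h1
        (isPreconnected_range (T k).continuous)
    exact IsPreconnected.union (f k) (Or.inr (hfT k)) hfk_ray h2 hray_conn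
  have hWJ : W ⊆ (range J)ᶜ := by
    rintro z (((hz | hz) | hz) | hz)
    · exact hSJ z hz
    · exact hball hz
    · exact hTk z hz
    · exact hrayJ z hz
  set zfar : ℂ := x + ((2 : ℝ) : ℂ) * (f k - x) with hzfar
  have hzfar_ray : zfar ∈ ray := ⟨2, mem_Ici.2 (by norm_num), rfl⟩
  have hzfar_dist : dist zfar x = 2 * q₂ := by rw [hzfar, dist_ray_point x (f k) (by norm_num), hf k]
  have hcomp : zfar ∈ connectedComponentIn (range J)ᶜ p :=
    hWc.subset_connectedComponentIn (Or.inl (Or.inl (Or.inl hp))) hWJ (Or.inr hzfar_ray)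
  /- the loop stays in the closed disc of radius `q₂` -/
  have hJle : ∀ z ∈ range J, dist z x ≤ q₂ := by
    intro z hz
    rcases mem_range_closeUp_cases _ _ _ _ _ _ _ _ hz with ⟨t, rfl⟩ | ⟨t, rfl⟩ | ⟨t, rfl⟩ | h | h
    · exact (hann i t).2
    · exact (dist_circleArc x hq₂.le φ₁ φ₂ t).le
    · exact (hann j t).2
    · exact (dist_le_of_mem_segment_center h).trans (by rw [he j]; exact hq₁₂.le)
    · rw [segment_symm] at h
      exact (dist_le_of_mem_segment_center h).trans (by rw [he i]; exact hq₁₂.le)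
  /- winding numbers -/
  have hw : wind (fun t => J.extend t - p) = wind (fun t => J.extend t - zfar) :=
    wind_sub_eq_of_mem_connectedComponentIn J.continuous_extend.continuousOn (by simp) hJc
      (fun t ht => by rw [Path.extend_apply _ ht]; exact ⟨_, rfl⟩) hcomp
  have hfar : wind (fun t => J.extend t - zfar) = 0 :=
    wind_sub_eq_zero_of_dist_le J.continuous_extend.continuousOn (by simp)
      (fun t ht => by rw [Path.extend_apply _ ht]; exact hJle _ ⟨_, rfl⟩) (by rw [hzfar_dist]; linarith)
  rw [Path.argInc_eq_wind_mul J (hSJ p hp), hw, hfar]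
  simp

/-! ### The theorem -/

/-- **Three disjoint arcs across an annulus are not all touched by one complementary region —
ordered form.** With the setting of `argInc_closeUp_eq_zero` and three distinct indices
`a, b, c` whose outer endpoints `f_a = x + q₂e^{iθ_a}`, … satisfy `θ_a < θ_b < θ_c < θ_a + 2π`,
the closure of `S` cannot meet all of `T_a`, `T_b`, `T_c` inside the open annulus: the three
close-up loops (outer arcs `[θ_a, θ_b]`, `[θ_b, θ_c]`, `[θ_c, θ_a + 2π]`, each missing the third
endpoint) have zero argument increment at a point `p ∈ S`, while the sum of the three
increments is that of the full outer circle, `2πi` (`argInc_three_circleArcs`; the `T`'s and the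
radii cancel). (Aizenman–Burchard 1999, App. A: the crossing segments cut the annulus into
sectors.) [cite: AizenmanBurchardDuke1999, Appendix A] -/
theorem not_three_arcs_touch_of_lt (hq₁ : 0 < q₁) (hq₁₂ : q₁ < q₂) (T : ∀ l, Path (e l) (f l))
    (he : ∀ l, dist (e l) x = q₁) (hf : ∀ l, dist (f l) x = q₂)
    (hann : ∀ l t, q₁ ≤ dist (T l t) x ∧ dist (T l t) x ≤ q₂)
    (hin : ∀ l t, dist (T l t) x = q₁ → T l t = e l)
    (hout : ∀ l t, dist (T l t) x = q₂ → T l t = f l)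
    (hdisj : ∀ l l', l ≠ l' → Disjoint (range (T l)) (range (T l')))
    {S : Set ℂ} (hS : IsPreconnected S) (hSann : ∀ z ∈ S, q₁ < dist z x ∧ dist z x < q₂)
    (hST : ∀ l, Disjoint S (range (T l)))
    {a b c : ι} (hab : a ≠ b) (hbc : b ≠ c) (hca : c ≠ a) {θa θb θc : ℝ}
    (hθa : f a = circleMap x q₂ θa) (hθb : f b = circleMap x q₂ θb)
    (hθc : f c = circleMap x q₂ θc) (h₁ : θa < θb) (h₂ : θb < θc) (h₃ : θc < θa + 2 * π)
    (hta : (closure S ∩ range (T a) ∩ {z | q₁ < dist z x ∧ dist z x < q₂}).Nonempty)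
    (htb : (closure S ∩ range (T b) ∩ {z | q₁ < dist z x ∧ dist z x < q₂}).Nonempty)
    (htc : (closure S ∩ range (T c) ∩ {z | q₁ < dist z x ∧ dist z x < q₂}).Nonempty) :
    False := by
  obtain ⟨p, hp⟩ : S.Nonempty := by
    obtain ⟨m, ⟨hm, -⟩, -⟩ := hta
    by_contra h
    rw [not_nonempty_iff_eq_empty] at h
    rw [h, closure_empty] at hm
    exact hm
  have hq₂ : 0 < q₂ := hq₁.trans hq₁₂
  have hq₂' : q₂ ≠ 0 := hq₂.ne'
  have hp1 := (hSann p hp).1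
  have hp2 := (hSann p hp).2
  -- periodic representatives of the endpoints
  have hθa' : f a = circleMap x q₂ (θa + 2 * π) := by rw [periodic_circleMap]; exact hθa
  have hθb' : f b = circleMap x q₂ (θb + 2 * π) := by rw [periodic_circleMap]; exact hθb
  -- each outer arc misses the third endpoint
  have hav₁ : f c ∉ range (circleArc x q₂ θa θb) := by
    rw [hθc]
    refine circleMap_not_mem_range_circleArc hq₂' fun n => ?_
    rw [uIcc_of_le h₁.le]
    exact forall_add_int_mul_not_mem_Icc h₂ h₃ n
  have hav₂ : f a ∉ range (circleArc x q₂ θb θc) := by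
    rw [hθa']
    refine circleMap_not_mem_range_circleArc hq₂' fun n => ?_
    rw [uIcc_of_le h₂.le]
    exact forall_add_int_mul_not_mem_Icc h₃ (by linarith) n
  have hav₃ : f b ∉ range (circleArc x q₂ θc (θa + 2 * π)) := by
    rw [hθb']
    refine circleMap_not_mem_range_circleArc hq₂' fun n => ?_
    rw [uIcc_of_le h₃.le]
    exact forall_add_int_mul_not_mem_Icc (by linarith) (by linarith) n
  -- the three close-up loops do not wind about `p`
  have z₁ := argInc_closeUp_eq_zero hq₁ hq₁₂ T he hf hann hin hout hdisj hS hSann hST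
    (Ne.symm hca) hbc hθa hθb hav₁ htc hp
  have z₂ := argInc_closeUp_eq_zero hq₁ hq₁₂ T he hf hann hin hout hdisj hS hSann hST
    (Ne.symm hab) hca hθb hθc hav₂ hta hp
  have z₃ := argInc_closeUp_eq_zero hq₁ hq₁₂ T he hf hann hin hout hdisj hS hSann hST
    (Ne.symm hbc) hab hθc hθa' hav₃ htb hp
  -- expand them: `p` is off every piece
  have hpT : ∀ l, p ∉ range (T l) := fun l => Set.disjoint_left.1 (hST l) hp
  have hparc : ∀ φ ψ : ℝ, p ∉ range (circleArc x q₂ φ ψ) := by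
    rintro φ ψ ⟨t, ht⟩
    have := dist_circleArc x hq₂.le φ ψ t
    rw [ht] at this
    linarith
  have hpseg : ∀ l, p ∉ segment ℝ (e l) x := fun l h => by
    have := dist_le_of_mem_segment_center h
    rw [he l] at this
    linarith
  have hpseg' : ∀ l, p ∉ segment ℝ x (e l) := fun l h => by
    rw [segment_symm] at h
    exact hpseg l h
  rw [argInc_closeUp _ _ _ _ _ _ _ _ (hpT _) (hparc _ _) (hpT _) (hpseg _) (hpseg' _)] at z₁ z₂ z₃
  -- the radii cancel
  have hs : ∀ l, (Path.segment x (e l)).argInc p = -(Path.segment (e l) x).argInc p := fun l => by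
    rw [← Path.segment_symm, Path.argInc_symm _ (by rw [Path.range_segment]; exact hpseg l)]
  have hsa := hs a
  have hsb := hs b
  have hsc := hs c
  -- the arcs add up to one turn
  have hsum := argInc_three_circleArcs (x := x) (p := p) (r := q₂) hp2 θa θb θc
  have key : (2 * π * I : ℂ) = 0 := by
    linear_combination z₁ + z₂ + z₃ - hsum - hsa - hsb - hsc
  exact two_pi_I_ne_zero key

/-- **Three pairwise disjoint arcs across an annulus are not all touched by one complementary
region.** Let `T_l`, `l : ι`, be paths in the closed annulus `q₁ ≤ |z - x| ≤ q₂` (`0 < q₁ < q₂`),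
`T_l` running from its only point `e_l` on the inner circle to its only point `f_l` on the outer
circle, with pairwise disjoint ranges, and let `S` be a preconnected subset of the open annulus
missing all of them. Then for three distinct indices `a, b, c` the closure of `S` cannot meet each
of `T_a`, `T_b`, `T_c` at a point of the open annulus. (The planar content of Aizenman–Burchard
1999, App. A: `k` such arcs cut the annulus into sectors, each adjacent to at most two arcs;
hence a map sending each arc to an adjacent complementary region is at most two-to-one.) Reduced
to `not_three_arcs_touch_of_lt` by choosing angle representatives `θ_a = arg (f_a - x)`,
`θ_b, θ_c ∈ (θ_a, θ_a + 2π)` (`toIocMod`) and ordering `θ_b`, `θ_c`.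
[cite: AizenmanBurchardDuke1999, Appendix A] -/
theorem not_three_arcs_touch (hq₁ : 0 < q₁) (hq₁₂ : q₁ < q₂) (T : ∀ l, Path (e l) (f l))
    (he : ∀ l, dist (e l) x = q₁) (hf : ∀ l, dist (f l) x = q₂)
    (hann : ∀ l t, q₁ ≤ dist (T l t) x ∧ dist (T l t) x ≤ q₂)
    (hin : ∀ l t, dist (T l t) x = q₁ → T l t = e l)
    (hout : ∀ l t, dist (T l t) x = q₂ → T l t = f l)
    (hdisj : ∀ l l', l ≠ l' → Disjoint (range (T l)) (range (T l')))
    {S : Set ℂ} (hS : IsPreconnected S) (hSann : ∀ z ∈ S, q₁ < dist z x ∧ dist z x < q₂)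
    (hST : ∀ l, Disjoint S (range (T l)))
    {a b c : ι} (hab : a ≠ b) (hbc : b ≠ c) (hca : c ≠ a)
    (hta : (closure S ∩ range (T a) ∩ {z | q₁ < dist z x ∧ dist z x < q₂}).Nonempty)
    (htb : (closure S ∩ range (T b) ∩ {z | q₁ < dist z x ∧ dist z x < q₂}).Nonempty)
    (htc : (closure S ∩ range (T c) ∩ {z | q₁ < dist z x ∧ dist z x < q₂}).Nonempty) :
    False := by
  have hq₂ : 0 < q₂ := hq₁.trans hq₁₂
  have hfT : ∀ l, f l ∈ range (T l) := fun l => ⟨1, (T l).target⟩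
  have hfne : ∀ {l l'}, l ≠ l' → f l ≠ f l' := fun {l l'} h hf' =>
    Set.disjoint_left.1 (hdisj _ _ h) (hfT l) (by rw [hf']; exact hfT l')
  -- polar form of the outer endpoints
  have hpolar : ∀ l, f l = circleMap x q₂ (arg (f l - x)) := by
    intro l
    have h1 := norm_mul_exp_arg_mul_I (f l - x)
    rw [← dist_eq_norm, hf l] at h1
    rw [circleMap, h1]
    ring
  set θa : ℝ := arg (f a - x) with hθa_def
  set θb : ℝ := toIocMod Real.two_pi_pos θa (arg (f b - x)) with hθb_def
  set θc : ℝ := toIocMod Real.two_pi_pos θa (arg (f c - x)) with hθc_def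
  have hθa : f a = circleMap x q₂ θa := hpolar a
  have hrep : ∀ l, circleMap x q₂ (toIocMod Real.two_pi_pos θa (arg (f l - x))) = f l := by
    intro l
    rw [← self_sub_toIocDiv_zsmul, (periodic_circleMap x q₂).sub_zsmul_eq, ← hpolar l]
  have hθb : f b = circleMap x q₂ θb := (hrep b).symm
  have hθc : f c = circleMap x q₂ θc := (hrep c).symm
  have hbmem : θb ∈ Ioc θa (θa + 2 * π) := toIocMod_mem_Ioc _ _ _
  have hcmem : θc ∈ Ioc θa (θa + 2 * π) := toIocMod_mem_Ioc _ _ _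
  have hθa' : f a = circleMap x q₂ (θa + 2 * π) := by rw [periodic_circleMap]; exact hθa
  have hb2 : θb < θa + 2 * π := by
    refine lt_of_le_of_ne hbmem.2 fun h => hfne hab ?_
    rw [hθa', hθb, h]
  have hc2 : θc < θa + 2 * π := by
    refine lt_of_le_of_ne hcmem.2 fun h => hfne (Ne.symm hca) ?_
    rw [hθa', hθc, h]
  have hbc' : θb ≠ θc := fun h => hfne hbc (by rw [hθb, hθc, h])
  rcases lt_or_gt_of_ne hbc' with h | h
  · exact not_three_arcs_touch_of_lt hq₁ hq₁₂ T he hf hann hin hout hdisj hS hSann hST hab hbc hca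
      hθa hθb hθc hbmem.1 h hc2 hta htb htc
  · exact not_three_arcs_touch_of_lt hq₁ hq₁₂ T he hf hann hin hout hdisj hS hSann hST
      (Ne.symm hca) (Ne.symm hbc) (Ne.symm hab) hθa hθc hθb hcmem.1 h hb2 hta htc htb

end Heart

end Literature.Topology.PlaneTopology
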